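import Literature.NumberTheory.EllipticCurves.FormalGroupMultiplicationUniversalProofs
import Mathlib.FieldTheory.IsAlgClosed.AlgebraicClosure
import Mathlib.RingTheory.PowerSeries.Expand
import HarnessLib

/-!
# The formal group of a nodal Weierstrass cubic is a Möbius conjugate of `𝔾̂_m`; in
# characteristic `p`, `[p]˜ = Xᵖ` (split node) or `[p]˜ = ĩ(Xᵖ)` (non-split node) — proofs

Topic `NumberTheory/EllipticCurves` (theorems; two auxiliary data definitions `nodalCubicOfSlopes`,
`nodalPhi`; no named fact). For the origin-nodal Weierstrass cubic

  `T(α, β) : y² − (α + β)xy − αβx² = x³`   (`a₁ = −(α+β)`, `a₂ = −αβ`, `a₃ = a₄ = a₆ = 0`)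

over ANY commutative ring — the normal form of a Weierstrass cubic with a node at `(0, 0)` and
tangent lines `y = αx`, `y = βx` there (Silverman, *AEC*, proof of Prop. III.1.4(a) and
Prop. III.2.5) — the formal group `T̂` (parameter `z = −x/y`, the tree's chord–tangent law
`formalGroupLaw`, multiplication maps `formalMul`, inverse `formalNeg`) is conjugate to the
multiplicative formal group by the Möbius series

  `Φ(z) = (1 + αz)/(1 + βz)`:   **`Φ([n]_T(z)) = Φ(z)ⁿ`**,  **`Φ(i_T(z)) = Φ(z)⁻¹`**

(`nodalPhi_subst_formalMul`, `nodalPhi_subst_formalNeg_mul_nodalPhi`). This is Silverman's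
isomorphism `E_ns → 𝔾_m`, `(x, y) ↦ (y − αx)/(y − βx)` (*AEC* III.2.5; the tree's
`singularModel.nodeHom`) read in the formal group: `(y − αx)/(y − βx) = (1 + αz)/(1 + βz)` for
`z = −x/y`. The proof is points-free: for `T` the inverse invariant differential is EXACTLY
`η_T = 1 − a₁z − a₂z² = (1 + αz)(1 + βz)` (`formalEta_nodalCubicOfSlopes`; the terms of `η` involving
`w(z)` carry the factors `a₃, a₄, a₆`), so `Φ'/Φ = (α − β)·ω_T` with `ω_T = η_T⁻¹` the integral
invariant differential (`formalInvDiff`); since `ω_T([n]z)·[n]' = n·ω_T` (the tree's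
`formalInvDiff_subst_formalMul_mul_derivative'`, Silverman IV.4.3, over every ring) both
`Φ([n]z)` and `Φⁿ` solve `g' = n(α − β)ω_T·g`, `g(0) = 1`, hence agree over the torsion-free
universal ring `ℤ[α, β]` (`PowerSeries.derivative.ext`) and then over every ring by base change.

**Characteristic `p`.** Over a field `k` of characteristic `p`, `Φ(z)ᵖ = Φ^{(p)}(zᵖ)` with
`Φ^{(p)} = (1 + αᵖz)/(1 + βᵖz)`. For an origin-nodal cubic `E` over `𝔽_p` (`a₃ = a₄ = a₆ = 0`,
`b₂ = a₁² + 4a₂ ≠ 0`) with tangent slopes `α, β ∈ 𝔽̄_p` (the roots of `m² + a₁m − a₂`), either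
`αᵖ = α` (the node is *split*: the slopes are rational) and then **`[p]˜(z) = zᵖ`**
(`formalMul_prime_eq_X_pow_of_nodal_split`), or `αᵖ = β` (non-split) and then `Φ^{(p)} = Φ⁻¹`,
so **`[p]˜(z) = ĩ(zᵖ)`** (`formalMul_prime_eq_formalNeg_subst_of_nodal_nonsplit`): Frobenius acts
on the torus `E_ns ≅ 𝔾_m` (resp. its quadratic twist) as `u ↦ uᵖ` (resp. `u ↦ u⁻ᵖ`), i.e. in
`End(Ê)` one has `[p] = Frob` (resp. `[p] = −Frob`) — the relation behind Honda's type `p − a_pT`,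
`a_p = ±1`, of the formal group of an elliptic curve at a prime of multiplicative reduction
(Honda 1968, Thm. 5; Honda 1970, Thm. 9).

## References

* J. H. Silverman, *The Arithmetic of Elliptic Curves*, 2nd ed., GTM 106 (2009): proof of
  Prop. III.1.4(a), Prop. III.2.5 (`E_ns ≅ K̄ˣ`, `(x,y) ↦ (y − α₁x − β₁)/(y − α₂x − β₂)`),
  Ex. 3.5 (non-split node), IV.1 (`z = −x/y`), IV.4.3. [SilvermanAEC2009]
* T. Honda, *On the theory of commutative formal groups*, J. Math. Soc. Japan 22 (1970),
  213–246, §6.2, Thm. 9 (held: `paper:doi-10-2969-jmsj-02220213`). [Honda1970]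
* T. Honda, *Formal groups and zeta-functions*, Osaka J. Math. 5 (1968), 199–213, Thm. 5.

## Design notes

Pure power-series algebra over a commutative ring; nothing is inverted except unit power series
(`PowerSeries.invOfUnit`). The transfer `ℤ[α, β] ⇒ R` uses `map_formalMul` and
`MvPolynomial.eval₂Hom`. The characteristic-`p` statements are proved after base change to
`AlgebraicClosure (ZMod p)` (injective on coefficients), where the tangent quadratic splits.
-/

noncomputable section

open PowerSeries Literature.NumberTheory.EllipticCurves

namespace WeierstrassCurve

/-! ### The origin-nodal cubic `T(α, β)` and the Möbius series `Φ = (1 + αz)/(1 + βz)` -/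

section Defs

variable {R : Type*} [CommRing R]

/-- **The origin-nodal Weierstrass cubic** `T(α, β) : y² − (α+β)xy − αβx² = x³`, i.e.
`a₁ = −(α + β)`, `a₂ = −αβ`, `a₃ = a₄ = a₆ = 0`: singular point `(0, 0)` with tangent cone
`(y − αx)(y − βx)` (a node iff `α ≠ β`). It is the tree's `singularModel 0 0 α β`
(Silverman, *AEC*, proof of III.1.4(a): "`a₃ = a₄ = a₆ = 0`" once the singular point is at the
origin). [cite: SilvermanAEC2009, Prop. III.2.5] -/
def nodalCubicOfSlopes (α β : R) : WeierstrassCurve R :=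
  ⟨-(α + β), -(α * β), 0, 0, 0⟩

/-- **The Möbius series `Φ(z) = (1 + αz)·(1 + βz)⁻¹ ∈ R⟦z⟧`** — Silverman's map
`(x, y) ↦ (y − αx)/(y − βx)` to `𝔾_m` in the parameter `z = −x/y`. [cite: SilvermanAEC2009, Prop. III.2.5] -/
def nodalPhi (α β : R) : R⟦X⟧ :=
  (1 + C α * X) * PowerSeries.invOfUnit (1 + C β * X) 1

variable (α β : R)

/-- Unfolding `a₁(T) = −(α + β)`. [folklore] -/
@[simp] theorem nodalCubicOfSlopes_a₁ : (nodalCubicOfSlopes α β).a₁ = -(α + β) := rfl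
/-- Unfolding `a₂(T) = −αβ`. [folklore] -/
@[simp] theorem nodalCubicOfSlopes_a₂ : (nodalCubicOfSlopes α β).a₂ = -(α * β) := rfl
/-- Unfolding `a₃(T) = 0`. [folklore] -/
@[simp] theorem nodalCubicOfSlopes_a₃ : (nodalCubicOfSlopes α β).a₃ = 0 := rfl
/-- Unfolding `a₄(T) = 0`. [folklore] -/
@[simp] theorem nodalCubicOfSlopes_a₄ : (nodalCubicOfSlopes α β).a₄ = 0 := rfl
/-- Unfolding `a₆(T) = 0`. [folklore] -/
@[simp] theorem nodalCubicOfSlopes_a₆ : (nodalCubicOfSlopes α β).a₆ = 0 := rfl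

/-- `T(α, β)` commutes with base change. [folklore] -/
theorem map_nodalCubicOfSlopes {S : Type*} [CommRing S] (φ : R →+* S) :
    (nodalCubicOfSlopes α β).map φ = nodalCubicOfSlopes (φ α) (φ β) := by
  ext <;> simp [nodalCubicOfSlopes, WeierstrassCurve.map]

/-- `b₂(T) = (α − β)²`. [folklore] -/
theorem nodalCubicOfSlopes_b₂ : (nodalCubicOfSlopes α β).b₂ = (α - β) ^ 2 := by
  simp only [b₂, nodalCubicOfSlopes_a₁, nodalCubicOfSlopes_a₂]; ring

/-- **`η_T = (1 + αz)(1 + βz)` exactly**: for `T(α, β)` the inverse invariant differential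
`η = dz/ω = 1 − (a₁z + a₂z² + 2a₃w + 2a₄zw + 3a₆w²)` has no `w`-terms. [Silverman AEC IV.1]
[folklore] -/
theorem formalEta_nodalCubicOfSlopes :
    (nodalCubicOfSlopes α β).formalEta = (1 + C α * X) * (1 + C β * X) := by
  rw [formalEta_def]
  simp only [nodalCubicOfSlopes_a₁, nodalCubicOfSlopes_a₂, nodalCubicOfSlopes_a₃, nodalCubicOfSlopes_a₄, nodalCubicOfSlopes_a₆, map_zero,
    map_neg, map_add, map_mul, zero_mul, mul_zero, add_zero]
  ring

/-- `(1 + βz) · (1 + βz)⁻¹ = 1`. [folklore] -/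
theorem one_add_mul_invOfUnit (β : R) :
    (1 + C β * X) * PowerSeries.invOfUnit (1 + C β * X) 1 = 1 :=
  mul_invOfUnit _ _ (by simp)

/-- `(1 + βz) · Φ = 1 + αz`. [folklore] -/
theorem one_add_mul_nodalPhi : (1 + C β * X) * nodalPhi α β = 1 + C α * X := by
  rw [nodalPhi, mul_left_comm, one_add_mul_invOfUnit, mul_one]

/-- `Φ(0) = 1`. [folklore] -/
@[simp] theorem constantCoeff_nodalPhi : constantCoeff (nodalPhi α β) = 1 := by
  simp [nodalPhi, constantCoeff_invOfUnit]

/-- `Φ = 1 + (α − β)z + O(z²)`. [folklore] -/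
theorem coeff_one_nodalPhi : coeff 1 (nodalPhi α β) = α - β := by
  have h := congrArg (coeff 1) (one_add_mul_nodalPhi α β)
  rw [add_mul, one_mul, map_add, mul_assoc, coeff_C_mul, coeff_succ_X_mul,
    coeff_zero_eq_constantCoeff_apply, constantCoeff_nodalPhi, mul_one, map_add, coeff_one,
    if_neg one_ne_zero, coeff_C_mul, coeff_one_X, mul_one, zero_add] at h
  linear_combination h

/-- `Φ` commutes with base change. [folklore] -/
theorem map_nodalPhi {S : Type*} [CommRing S] (φ : R →+* S) :
    PowerSeries.map φ (nodalPhi α β) = nodalPhi (φ α) (φ β) := by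
  rw [nodalPhi, nodalPhi, map_mul, map_invOfUnit_one φ _ (by simp)]
  simp only [map_add, map_one, map_mul, PowerSeries.map_C, PowerSeries.map_X]

/-- `Φ(β, α) · Φ(α, β) = 1`: swapping the slopes inverts `Φ`. [folklore] -/
theorem nodalPhi_swap_mul : nodalPhi β α * nodalPhi α β = 1 := by
  rw [nodalPhi, nodalPhi]
  calc (1 + C β * X) * PowerSeries.invOfUnit (1 + C α * X) 1 *
        ((1 + C α * X) * PowerSeries.invOfUnit (1 + C β * X) 1)
        = ((1 + C α * X) * PowerSeries.invOfUnit (1 + C α * X) 1) *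
            ((1 + C β * X) * PowerSeries.invOfUnit (1 + C β * X) 1) := by ring
    _ = 1 := by rw [one_add_mul_invOfUnit, one_add_mul_invOfUnit, mul_one]

/-- `d/dz (1 + γz) = γ`. [folklore] -/
theorem derivative_one_add_C_mul_X (γ : R) : d⁄dX R (1 + C γ * X) = C γ := by
  rw [map_add, Derivation.map_one_eq_zero, Derivation.leibniz, derivative_X, derivative_C,
    smul_zero, add_zero, smul_eq_mul, mul_one, zero_add]

/-- **`Φ' · η_T = (α − β) · Φ`**, i.e. `Φ'/Φ = (α − β)ω_T` (`ω_T = η_T⁻¹ = dz/((1 + αz)(1 + βz))`):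
the logarithmic derivative of the Möbius series is `(α − β)` times the invariant differential of
the nodal cubic. [Silverman AEC III.2.5 with IV.4] [folklore] -/
theorem derivative_nodalPhi_mul_formalEta :
    d⁄dX R (nodalPhi α β) * (nodalCubicOfSlopes α β).formalEta = C (α - β) * nodalPhi α β := by
  set v := PowerSeries.invOfUnit (1 + C β * X) 1 with hvdef
  have hv : (1 + C β * X) * v = 1 := one_add_mul_invOfUnit β
  have hdv : d⁄dX R v = -v ^ 2 * C β := by
    have h := (d⁄dX R).leibniz_of_mul_eq_one (show v * (1 + C β * X) = 1 by rw [mul_comm, hv])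
    rw [h, smul_eq_mul, derivative_one_add_C_mul_X]
  have hdΦ : d⁄dX R (nodalPhi α β) = C α * v + (1 + C α * X) * (-v ^ 2 * C β) := by
    rw [nodalPhi, ← hvdef, Derivation.leibniz, hdv, derivative_one_add_C_mul_X, smul_eq_mul,
      smul_eq_mul]
    ring
  rw [hdΦ, formalEta_nodalCubicOfSlopes, nodalPhi, ← hvdef, map_sub]
  linear_combination (-(C β) * (1 + C α * X) ^ 2 * v) * hv

/-- `(C r)(u) = C r` for a substitution `u`. [folklore] -/
theorem subst_C' {a : R⟦X⟧} (ha : HasSubst a) (r : R) : (C r : R⟦X⟧).subst a = C r := by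
  rw [← Polynomial.coe_C, subst_coe ha, Polynomial.aeval_C, Polynomial.coe_C, C_eq_algebraMap]

end Defs

/-! ### `Φ([n]_T) = Φⁿ` and `Φ(i_T) = Φ⁻¹` over every commutative ring -/

section Conjugation

variable {R : Type*} [CommRing R] (α β : R)

/-- `Φ([n]_T(z)) = Φ(z)ⁿ` over an additively torsion-free ring (the ODE argument).
[Silverman AEC III.2.5, IV.4.3] [folklore] -/
theorem nodalPhi_subst_formalMul_of_isAddTorsionFree [IsAddTorsionFree R] (n : ℕ) :
    (nodalPhi α β).subst ((nodalCubicOfSlopes α β).formalMul n) = nodalPhi α β ^ n := by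
  set T := nodalCubicOfSlopes α β with hT
  set Φ := nodalPhi α β with hΦ
  set N := T.formalMul n with hN
  have hN0 : constantCoeff N = 0 := T.constantCoeff_formalMul n
  have hNs : HasSubst N := HasSubst.of_constantCoeff_zero' hN0
  have hηω : T.formalEta * T.formalInvDiff = 1 := T.formalEta_mul_formalInvDiff
  -- `Φ' = (α − β) Φ ω`
  have hΦ' : d⁄dX R Φ = C (α - β) * Φ * T.formalInvDiff := by
    calc d⁄dX R Φ = d⁄dX R Φ * (T.formalEta * T.formalInvDiff) := by rw [hηω, mul_one]
      _ = (d⁄dX R Φ * T.formalEta) * T.formalInvDiff := by ring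
      _ = C (α - β) * Φ * T.formalInvDiff := by rw [hΦ, hT, derivative_nodalPhi_mul_formalEta]
  -- `g = Φ(N)` solves `g' = (α − β)·nω·g`
  set g := Φ.subst N with hg
  have hg' : d⁄dX R g = C (α - β) * (n • T.formalInvDiff) * g := by
    rw [hg, derivative_subst R hNs, hΦ', subst_mul hNs, subst_mul hNs, subst_C' hNs, mul_assoc, mul_assoc,
      T.formalInvDiff_subst_formalMul_mul_derivative' n]
    ring
  -- so does `h = Φⁿ`
  have hh' : d⁄dX R (Φ ^ n) = C (α - β) * (n • T.formalInvDiff) * Φ ^ n := by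
    rw [derivative_pow, hΦ']
    rcases n with _ | m
    · simp
    · rw [Nat.add_sub_cancel, pow_succ, nsmul_eq_mul]
      push_cast
      ring
  -- `u = g · (Φⁿ)⁻¹` has `u' = 0`, `u(0) = 1`
  have hΦc : constantCoeff Φ = 1 := constantCoeff_nodalPhi α β
  have hhc : constantCoeff (Φ ^ n) = 1 := by rw [map_pow, hΦc, one_pow]
  have hgc : constantCoeff g = 1 := by rw [hg, constantCoeff_subst_eq_constantCoeff hN0, hΦc]
  set hi := PowerSeries.invOfUnit (Φ ^ n) 1 with hhi_def
  have hhi : Φ ^ n * hi = 1 := mul_invOfUnit _ _ (by rw [hhc, Units.val_one])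
  have hdhi : d⁄dX R hi = -hi ^ 2 * d⁄dX R (Φ ^ n) := by
    have h := (d⁄dX R).leibniz_of_mul_eq_one (show hi * Φ ^ n = 1 by rw [mul_comm, hhi])
    rw [h, smul_eq_mul]
  have hu : g * hi = 1 := by
    apply PowerSeries.derivative.ext
    · rw [Derivation.leibniz, hdhi, hg', hh', Derivation.map_one_eq_zero, smul_eq_mul, smul_eq_mul]
      linear_combination (-(C (α - β) * (n • T.formalInvDiff)) * g * hi) * hhi
    · rw [map_mul, hgc, one_mul, map_one, hhi_def, constantCoeff_invOfUnit, inv_one, Units.val_one]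
  calc g = g * (Φ ^ n * hi) := by rw [hhi, mul_one]
    _ = (g * hi) * Φ ^ n := by ring
    _ = Φ ^ n := by rw [hu, one_mul]

/-- **`Φ([n]_T(z)) = Φ(z)ⁿ` for every `n` over EVERY commutative ring**: the Möbius series
conjugates the formal multiplication maps of the nodal cubic into the powers `u ↦ uⁿ` of `𝔾̂_m`
(Silverman's isomorphism `E_ns ≅ 𝔾_m`, *AEC* III.2.5, in the formal group). Universal case over
`ℤ[α, β]`, then base change. [cite: SilvermanAEC2009, Prop. III.2.5] -/
theorem nodalPhi_subst_formalMul (n : ℕ) :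
    (nodalPhi α β).subst ((nodalCubicOfSlopes α β).formalMul n) = nodalPhi α β ^ n := by
  set φ : MvPolynomial (Fin 2) ℤ →+* R := MvPolynomial.eval₂Hom (Int.castRingHom R) ![α, β] with hφ
  have h0 : φ (MvPolynomial.X 0) = α := by simp [hφ]
  have h1 : φ (MvPolynomial.X 1) = β := by simp [hφ]
  have hU := nodalPhi_subst_formalMul_of_isAddTorsionFree (R := MvPolynomial (Fin 2) ℤ)
    (MvPolynomial.X 0) (MvPolynomial.X 1) n
  have h := congrArg (PowerSeries.map φ) hU
  rwa [powerSeries_map_subst φ (hasSubst_formalMul _ n), map_formalMul, map_nodalCubicOfSlopes, map_nodalPhi,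
    map_pow, map_nodalPhi, h0, h1] at h

/-- `i_T · (1 + (α + β)z) = −z`: the formal inverse of the nodal cubic is the Möbius series
`i_T(z) = −z/(1 + (α+β)z)` (`a₃ = 0`). [Silverman AEC IV.1 (`i(z) = x(z)/(y(z) + a₁x(z) + a₃)`)]
[folklore] -/
theorem formalNeg_nodalCubicOfSlopes_mul :
    (nodalCubicOfSlopes α β).formalNeg * (1 + C (α + β) * X) = -X := by
  have h := (nodalCubicOfSlopes α β).formalNeg_mul_formalNegDenom
  simp only [nodalCubicOfSlopes_a₁, nodalCubicOfSlopes_a₃, map_zero, zero_mul, sub_zero, map_neg] at h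
  rw [← h]
  ring

/-- **`Φ(i_T(z)) · Φ(z) = 1`**: the Möbius series carries the formal inverse of the nodal cubic
to the inverse of `𝔾̂_m`. [cite: SilvermanAEC2009, Prop. III.2.5] -/
theorem nodalPhi_subst_formalNeg_mul_nodalPhi :
    (nodalPhi α β).subst (nodalCubicOfSlopes α β).formalNeg * nodalPhi α β = 1 := by
  set T := nodalCubicOfSlopes α β with hT
  set ι := T.formalNeg with hι
  have hι0 : constantCoeff ι = 0 := T.constantCoeff_formalNeg
  have hιs : HasSubst ι := HasSubst.of_constantCoeff_zero' hι0
  have hCαβ : (C (α + β) : R⟦X⟧) = C α + C β := map_add C α β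
  have hιD : ι * (1 + (C α + C β) * X) = -X := by rw [← hCαβ]; exact formalNeg_nodalCubicOfSlopes_mul α β
  set v := PowerSeries.invOfUnit (1 + C β * X) 1 with hvdef
  have hv : (1 + C β * X) * v = 1 := one_add_mul_invOfUnit β
  -- `J = v(ι)` is the inverse of `1 + βι`
  have hJ : (1 + C β * ι) * v.subst ι = 1 := by
    have h := congrArg (PowerSeries.subst ι) hv
    rwa [subst_mul hιs, ← coe_substAlgHom hιs, map_add, map_one, map_mul, coe_substAlgHom,
      subst_C' hιs, subst_X hιs] at h
  have hΦι : (nodalPhi α β).subst ι = (1 + C α * ι) * v.subst ι := by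
    rw [nodalPhi, ← hvdef, subst_mul hιs, ← coe_substAlgHom hιs, map_add, map_one, map_mul,
      coe_substAlgHom, subst_C' hιs, subst_X hιs]
  have h1 : (1 + C β * ι) * (1 + (C α + C β) * X) = 1 + C α * X := by
    linear_combination (C β) * hιD
  have h2 : (1 + C α * ι) * (1 + (C α + C β) * X) = 1 + C β * X := by
    linear_combination (C α) * hιD
  rw [hΦι, nodalPhi, ← hvdef]
  calc (1 + C α * ι) * v.subst ι * ((1 + C α * X) * v)
      = (1 + C α * ι) * v.subst ι * (((1 + C β * ι) * (1 + (C α + C β) * X)) * v) := by rw [h1]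
    _ = ((1 + C α * ι) * (1 + (C α + C β) * X)) * ((1 + C β * ι) * v.subst ι) * v := by ring
    _ = 1 := by rw [h2, hJ, mul_one, hv]

/-- `Φ(i_T(u)) · Φ(u) = 1` after any substitution. [folklore] -/
theorem nodalPhi_subst_formalNeg_subst_mul {u : R⟦X⟧} (hu : constantCoeff u = 0) :
    (nodalPhi α β).subst ((nodalCubicOfSlopes α β).formalNeg.subst u) * (nodalPhi α β).subst u = 1 := by
  have hus : HasSubst u := HasSubst.of_constantCoeff_zero' hu
  have h := congrArg (PowerSeries.subst u) (nodalPhi_subst_formalNeg_mul_nodalPhi α β)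
  rwa [subst_mul hus, subst_comp_subst_apply
    (HasSubst.of_constantCoeff_zero' (nodalCubicOfSlopes α β).constantCoeff_formalNeg) hus,
    ← coe_substAlgHom hus, map_one, coe_substAlgHom] at h

end Conjugation

/-! ### Characteristic `p`: `Φᵖ = Φ^{(p)}(zᵖ)` and the two cases `[p]˜ = zᵖ`, `[p]˜ = ĩ(zᵖ)` -/

section CharP

variable {k : Type*} [Field k] {p : ℕ} [hp : Fact p.Prime] [CharP k p] (α β : k)

/-- **Frobenius on the Möbius series**: `Φ_{α,β}(z)ᵖ = Φ_{αᵖ,βᵖ}(zᵖ)` in characteristic `p`.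
[folklore] -/
theorem nodalPhi_pow_prime :
    nodalPhi α β ^ p = (nodalPhi (α ^ p) (β ^ p)).subst ((X : k⟦X⟧) ^ p) := by
  have hp0 : p ≠ 0 := hp.out.ne_zero
  haveI : CharP k⟦X⟧ p := charP_of_injective_ringHom (f := (C : k →+* k⟦X⟧))
    (fun a b h ↦ by simpa using congrArg constantCoeff h) p
  have hXs : HasSubst ((X : k⟦X⟧) ^ p) := HasSubst.X_pow hp0
  set v := PowerSeries.invOfUnit (1 + C β * X) 1 with hvdef
  have hv : (1 + C β * X) * v = 1 := one_add_mul_invOfUnit β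
  set v' := PowerSeries.invOfUnit (1 + C (β ^ p) * X) 1 with hv'def
  have hv' : (1 + C (β ^ p) * X) * v' = 1 := one_add_mul_invOfUnit (β ^ p)
  have hfrob : ∀ γ : k, (1 + C γ * X : k⟦X⟧) ^ p = 1 + C (γ ^ p) * X ^ p := fun γ ↦ by
    rw [add_pow_char, one_pow, mul_pow, ← map_pow]
  -- `vᵖ` and `v'(Xᵖ)` both invert `1 + βᵖ Xᵖ`
  have h1 : (1 + C (β ^ p) * X ^ p) * v ^ p = 1 := by rw [← hfrob, ← mul_pow, hv, one_pow]
  have h2 : (1 + C (β ^ p) * X ^ p) * v'.subst (X ^ p) = 1 := by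
    have h := congrArg (PowerSeries.subst ((X : k⟦X⟧) ^ p)) hv'
    rwa [subst_mul hXs, ← coe_substAlgHom hXs, map_add, map_one, map_mul, coe_substAlgHom,
      subst_C' hXs, subst_X hXs] at h
  have hvv : v ^ p = v'.subst (X ^ p) :=
    (IsUnit.of_mul_eq_one _ h1).mul_left_cancel (h1.trans h2.symm)
  rw [nodalPhi, ← hvdef, mul_pow, hfrob, hvv, nodalPhi, ← hv'def, subst_mul hXs, ← coe_substAlgHom hXs,
    map_add, map_one, map_mul, coe_substAlgHom, subst_C' hXs, subst_X hXs]

/-- **Injectivity of `u ↦ Φ(u)`** on series without constant term (`α ≠ β`: `Φ = 1 + (α−β)z + ⋯`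
has a compositional quasi-inverse). [folklore] -/
theorem eq_of_nodalPhi_subst_eq (hαβ : α ≠ β) {u v : k⟦X⟧} (hu : constantCoeff u = 0)
    (hv : constantCoeff v = 0) (h : (nodalPhi α β).subst u = (nodalPhi α β).subst v) : u = v := by
  have hus : HasSubst u := HasSubst.of_constantCoeff_zero' hu
  have hvs : HasSubst v := HasSubst.of_constantCoeff_zero' hv
  set Ψ : k⟦X⟧ := nodalPhi α β - 1 with hΨ
  have hΨ0 : constantCoeff Ψ = 0 := by rw [hΨ, map_sub, constantCoeff_nodalPhi, map_one, sub_self]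
  have hΨ1 : IsUnit (coeff 1 Ψ) := by
    rw [hΨ, map_sub, coeff_one_nodalPhi, coeff_one, if_neg one_ne_zero, sub_zero]
    exact (sub_ne_zero.mpr hαβ).isUnit
  have hΨuv : Ψ.subst u = Ψ.subst v := by
    rw [hΨ, ← coe_substAlgHom hus, ← coe_substAlgHom hvs, map_sub, map_sub, map_one, map_one,
      coe_substAlgHom, coe_substAlgHom, h]
  set G := Ψ.substInvOfIsUnit hΨ1 with hG
  have hGΨ : G.subst Ψ = X := subst_substInvOfIsUnit_left Ψ hΨ0 hΨ1
  have hΨs : HasSubst Ψ := HasSubst.of_constantCoeff_zero' hΨ0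
  have key : G.subst (Ψ.subst u) = G.subst (Ψ.subst v) := by rw [hΨuv]
  rw [← subst_comp_subst_apply hΨs hus, ← subst_comp_subst_apply hΨs hvs, hGΨ, subst_X hus,
    subst_X hvs] at key
  exact key

/-- **Split node: `[p]˜(z) = zᵖ`.** If the slopes are Frobenius-fixed (`αᵖ = α`, `βᵖ = β`,
`α ≠ β`) then the multiplication-by-`p` series of `T(α, β)` is `zᵖ` — on `E_ns ≅ 𝔾_m` Frobenius
is `u ↦ uᵖ = [p]u`. [cite: SilvermanAEC2009, Prop. III.2.5] -/
theorem formalMul_prime_nodalCubicOfSlopes_of_pow_eq (hαβ : α ≠ β) (hα : α ^ p = α) (hβ : β ^ p = β) :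
    (nodalCubicOfSlopes α β).formalMul p = (X : k⟦X⟧) ^ p := by
  have hp0 : p ≠ 0 := hp.out.ne_zero
  refine eq_of_nodalPhi_subst_eq α β hαβ ((nodalCubicOfSlopes α β).constantCoeff_formalMul p)
    (by rw [map_pow, constantCoeff_X, zero_pow hp0]) ?_
  rw [nodalPhi_subst_formalMul, nodalPhi_pow_prime, hα, hβ]

/-- **Non-split node: `[p]˜(z) = ĩ(zᵖ)`.** If Frobenius swaps the slopes (`αᵖ = β`, `βᵖ = α`,
`α ≠ β`) then the multiplication-by-`p` series of `T(α, β)` is `i_T(zᵖ)` — on the twisted torus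
Frobenius is `u ↦ u⁻ᵖ = −[p]u`. [cite: SilvermanAEC2009, Prop. III.2.5 and Ex. 3.5] -/
theorem formalMul_prime_nodalCubicOfSlopes_of_pow_eq_swap (hαβ : α ≠ β) (hα : α ^ p = β) (hβ : β ^ p = α) :
    (nodalCubicOfSlopes α β).formalMul p = (nodalCubicOfSlopes α β).formalNeg.subst ((X : k⟦X⟧) ^ p) := by
  have hp0 : p ≠ 0 := hp.out.ne_zero
  have hXp : constantCoeff ((X : k⟦X⟧) ^ p) = 0 := by rw [map_pow, constantCoeff_X, zero_pow hp0]
  have hXs : HasSubst ((X : k⟦X⟧) ^ p) := HasSubst.X_pow hp0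
  have hι0 : constantCoeff ((nodalCubicOfSlopes α β).formalNeg.subst ((X : k⟦X⟧) ^ p)) = 0 := by
    rw [constantCoeff_subst_eq_constantCoeff hXp, constantCoeff_formalNeg]
  refine eq_of_nodalPhi_subst_eq α β hαβ ((nodalCubicOfSlopes α β).constantCoeff_formalMul p) hι0 ?_
  -- both sides are the inverse of `Φ(zᵖ)`
  have hA : (nodalPhi α β).subst ((nodalCubicOfSlopes α β).formalMul p) * (nodalPhi α β).subst (X ^ p) = 1 := by
    rw [nodalPhi_subst_formalMul, nodalPhi_pow_prime, hα, hβ, ← subst_mul hXs, nodalPhi_swap_mul,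
      ← coe_substAlgHom hXs, map_one]
  have hB := nodalPhi_subst_formalNeg_subst_mul α β hXp
  have hunit : IsUnit ((nodalPhi α β).subst ((X : k⟦X⟧) ^ p)) := IsUnit.of_mul_eq_one_right _ hB
  exact (IsUnit.mul_left_inj hunit).mp (hA.trans hB.symm)

end CharP

/-! ### Origin-nodal cubics over `𝔽_p` -/

section ZMod

variable {p : ℕ} [hp : Fact p.Prime] (E : WeierstrassCurve (ZMod p))

/-- An origin-nodal cubic over `𝔽_p` is `T(α, β)` over `𝔽̄_p` with `α, β` the roots of the tangent
quadratic `m² + a₁m − a₂`; `α ≠ β` iff `b₂ ≠ 0`, and Frobenius either fixes or swaps the slopes.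
[Silverman AEC, proof of III.1.4(a)] [folklore] -/
theorem exists_map_eq_nodalCubicOfSlopes (h₃ : E.a₃ = 0) (h₄ : E.a₄ = 0) (h₆ : E.a₆ = 0) (hb₂ : E.b₂ ≠ 0) :
    ∃ α β : AlgebraicClosure (ZMod p),
      E.map (algebraMap (ZMod p) (AlgebraicClosure (ZMod p))) = nodalCubicOfSlopes α β ∧ α ≠ β ∧
      α ^ 2 + algebraMap (ZMod p) _ E.a₁ * α - algebraMap (ZMod p) _ E.a₂ = 0 ∧
      ((α ^ p = α ∧ β ^ p = β) ∨ (α ^ p = β ∧ β ^ p = α)) := by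
  set k := AlgebraicClosure (ZMod p)
  set ι := algebraMap (ZMod p) k with hι
  haveI : ExpChar k p := ExpChar.prime hp.out
  -- a root of `m² + a₁ m − a₂`
  obtain ⟨α, hα⟩ := IsAlgClosed.exists_root
    (Polynomial.C 1 * Polynomial.X ^ 2 + Polynomial.C (ι E.a₁) * Polynomial.X + Polynomial.C (-(ι E.a₂)))
    (by rw [Polynomial.degree_quadratic one_ne_zero]; decide)
  simp only [Polynomial.IsRoot.def, Polynomial.eval_add, Polynomial.eval_mul, Polynomial.eval_C,
    Polynomial.eval_pow, Polynomial.eval_X, one_mul] at hα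
  set β := -ι E.a₁ - α with hβ
  have hsum : α + β = -ι E.a₁ := by rw [hβ]; ring
  have hprod : α * β = -ι E.a₂ := by rw [hβ]; linear_combination -hα
  have hE : E.map ι = nodalCubicOfSlopes α β := by
    ext
    · simp only [map_a₁, nodalCubicOfSlopes_a₁]; linear_combination hsum
    · simp only [map_a₂, nodalCubicOfSlopes_a₂]; linear_combination hprod
    · simp only [map_a₃, nodalCubicOfSlopes_a₃, h₃, map_zero]
    · simp only [map_a₄, nodalCubicOfSlopes_a₄, h₄, map_zero]
    · simp only [map_a₆, nodalCubicOfSlopes_a₆, h₆, map_zero]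
  have hαβ : α ≠ β := by
    intro h
    apply hb₂
    have hb : ι E.b₂ = (α - β) ^ 2 := by rw [← map_b₂, hE, nodalCubicOfSlopes_b₂]
    rw [h, sub_self, zero_pow two_ne_zero] at hb
    exact (map_eq_zero ι).mp hb
  -- Frobenius permutes the roots
  have hfix : ∀ a : ZMod p, (ι a) ^ p = ι a := fun a ↦ by rw [← map_pow, ZMod.pow_card]
  have hαp : (α ^ p) ^ 2 + ι E.a₁ * α ^ p - ι E.a₂ = 0 := by
    have h := congrArg (frobenius k p) hα
    simp only [map_add, map_neg, map_mul, map_pow, map_zero, frobenius_def, hfix] at h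
    linear_combination h
  have hroot : (α ^ p - α) * (α ^ p - β) = 0 := by
    linear_combination hαp - (α ^ p) * hsum + hprod
  have hβp : β ^ p = -ι E.a₁ - α ^ p := by
    calc β ^ p = frobenius k p β := (frobenius_def ..).symm
      _ = -ι E.a₁ - α ^ p := by rw [hβ, map_sub, map_neg, frobenius_def, frobenius_def, hfix]
  refine ⟨α, β, hE, hαβ, by linear_combination hα, ?_⟩
  rcases mul_eq_zero.mp hroot with h | h
  · left
    have hα' : α ^ p = α := sub_eq_zero.mp h
    exact ⟨hα', by rw [hβp, hα', hβ]⟩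
  · right
    have hα' : α ^ p = β := sub_eq_zero.mp h
    exact ⟨hα', by rw [hβp, hα']; linear_combination -hsum⟩

/-- A Frobenius-fixed element of `𝔽̄_p` is in `𝔽_p` (the prime field). [folklore] -/
theorem exists_algebraMap_eq_of_pow_eq {a : AlgebraicClosure (ZMod p)} (ha : a ^ p = a) :
    ∃ m : ZMod p, algebraMap (ZMod p) (AlgebraicClosure (ZMod p)) m = a := by
  obtain ⟨n, hn⟩ := (mem_bot_iff_intCast p (AlgebraicClosure (ZMod p))).mp
    ((Subfield.mem_bot_iff_pow_eq_self (AlgebraicClosure (ZMod p)) p).mpr ha)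
  exact ⟨n, by rw [map_intCast, hn]⟩

/-- **Split origin-nodal cubic over `𝔽_p`: `[p]˜(z) = zᵖ`.** For a Weierstrass cubic `E/𝔽_p`
with `a₃ = a₄ = a₆ = 0` (singular point at the origin), `b₂ ≠ 0` (a node) and a RATIONAL
tangent slope (a root `m ∈ 𝔽_p` of `m² + a₁m − a₂`), the multiplication-by-`p` series of the
formal group is `zᵖ`: Frobenius is `[p]` on `E_ns ≅ 𝔾_m`. [cite: SilvermanAEC2009, Prop. III.2.5] -/
theorem formalMul_prime_eq_X_pow_of_nodal_split (h₃ : E.a₃ = 0) (h₄ : E.a₄ = 0) (h₆ : E.a₆ = 0)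
    (hb₂ : E.b₂ ≠ 0) (hsplit : ∃ m : ZMod p, m ^ 2 + E.a₁ * m - E.a₂ = 0) :
    E.formalMul p = (X : (ZMod p)⟦X⟧) ^ p := by
  obtain ⟨α, β, hE, hαβ, hα, hfrob⟩ := E.exists_map_eq_nodalCubicOfSlopes h₃ h₄ h₆ hb₂
  obtain ⟨m, hm⟩ := hsplit
  set ι := algebraMap (ZMod p) (AlgebraicClosure (ZMod p)) with hι
  have hfix : ∀ a : ZMod p, (ι a) ^ p = ι a := fun a ↦ by rw [← map_pow, ZMod.pow_card]
  have hsum : α + β = -ι E.a₁ := by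
    have h := congrArg WeierstrassCurve.a₁ hE; rw [map_a₁, nodalCubicOfSlopes_a₁] at h; linear_combination h
  have hprod : α * β = -ι E.a₂ := by
    have h := congrArg WeierstrassCurve.a₂ hE; rw [map_a₂, nodalCubicOfSlopes_a₂] at h; linear_combination h
  -- `ι m ∈ {α, β}`, so the slopes are Frobenius-fixed
  have hmαβ : (ι m - α) * (ι m - β) = 0 := by
    have h := congrArg ι hm
    rw [map_zero, map_sub, map_add, map_pow, map_mul] at h
    linear_combination h - (ι m) * hsum + hprod
  have hfixed : α ^ p = α ∧ β ^ p = β := by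
    rcases hfrob with h | ⟨h1, h2⟩
    · exact h
    · exfalso
      rcases mul_eq_zero.mp hmαβ with h | h
      · have hmα : ι m = α := sub_eq_zero.mp h
        exact hαβ (by rw [← h1, ← hmα, hfix])
      · have hmβ : ι m = β := sub_eq_zero.mp h
        exact hαβ (by rw [← h2, ← hmβ, hfix])
  apply PowerSeries.map_injective ι (RingHom.injective ι)
  rw [map_formalMul, hE, map_pow, PowerSeries.map_X]
  exact formalMul_prime_nodalCubicOfSlopes_of_pow_eq α β hαβ hfixed.1 hfixed.2

/-- **Non-split origin-nodal cubic over `𝔽_p`: `[p]˜(z) = ĩ(zᵖ)`.** For a Weierstrass cubic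
`E/𝔽_p` with `a₃ = a₄ = a₆ = 0`, `b₂ ≠ 0` and IRRATIONAL tangent slopes (`m² + a₁m − a₂` has no
root in `𝔽_p`), the multiplication-by-`p` series of the formal group is `i(zᵖ)`, `i` the formal
inverse: Frobenius is `−[p]` on the non-split torus. [cite: SilvermanAEC2009, Prop. III.2.5 and Ex. 3.5] -/
theorem formalMul_prime_eq_formalNeg_subst_of_nodal_nonsplit (h₃ : E.a₃ = 0) (h₄ : E.a₄ = 0)
    (h₆ : E.a₆ = 0) (hb₂ : E.b₂ ≠ 0) (hns : ∀ m : ZMod p, m ^ 2 + E.a₁ * m - E.a₂ ≠ 0) :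
    E.formalMul p = E.formalNeg.subst ((X : (ZMod p)⟦X⟧) ^ p) := by
  have hp0 : p ≠ 0 := hp.out.ne_zero
  obtain ⟨α, β, hE, hαβ, hα, hfrob⟩ := E.exists_map_eq_nodalCubicOfSlopes h₃ h₄ h₆ hb₂
  set ι := algebraMap (ZMod p) (AlgebraicClosure (ZMod p)) with hι
  have hswap : α ^ p = β ∧ β ^ p = α := by
    rcases hfrob with ⟨h1, -⟩ | h
    · exfalso
      obtain ⟨m, hm⟩ := exists_algebraMap_eq_of_pow_eq h1
      apply hns m
      apply RingHom.injective ι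
      rw [map_zero, map_sub, map_add, map_pow, map_mul, hm]
      exact hα
    · exact h
  apply PowerSeries.map_injective ι (RingHom.injective ι)
  rw [map_formalMul, hE, powerSeries_map_subst ι (HasSubst.X_pow hp0), map_formalNeg, hE, map_pow,
    PowerSeries.map_X]
  exact formalMul_prime_nodalCubicOfSlopes_of_pow_eq_swap α β hαβ hswap.1 hswap.2

end ZMod

end WeierstrassCurve
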